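import Summits.HodgeConjecture.HodgeConjecture.Theorems.F0LD1ThetaTransportKit
import Summits.HodgeConjecture.HodgeConjecture.Theorems.F0LD2FrameTransportPin
import Literature.NumberTheory.Automorphic.HilbertRepSpectrumProofs
import HarnessLib

-- As in the lineage (★ `ThetaLiftFromLineCentralCharacter`): statements over the theta-kernel datum elaborate to very large types; elaborate sequentially.
set_option Elab.async false

/-!
# Crux `HLiu418`, line LD1, organ (I) `stub_thetaCharRigid`, half (I-A) — BRICK 1: «an IRREDUCIBLE closed invariant subspace containing every
# `(a, ξ)`-theta class and meeting `P` in a non-zero `(a, ξ)`-theta class lies inside `P`» (so `CharSeam₂ ⟹ CharThetaSpaceLe₂` GIVEN irreducibility),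
# and the THETA SPAN: the closure of the span of all `(a, ξ)`-theta classes IS a closed `R`-invariant subspace containing them

Cell hodgecm-mathlib (D-0151), FLOOR 0; crux item `HLiu418` = stmt-HodgeConjecture-24832; half-A line LD1 (`stub_S1_facts` = #73 E1θhol of socket 27458
`Cruxes/HLiu418/Lines/F0_AlbCm.lean`), θ-road skeleton `F0/P6/LD/LD1-plan/g0/StubS1facts.inhouse.skeleton.v7.lean` (LD1-plan (g0)), organ (I)
`ThetaCharRigid₂ = «Meets ⇒ ∃ ξ, CharThetaSpaceLe₂ ∧ CharSeam₂»`, half (I-A) = `CharThetaSpaceLe₂` (LD1-plan re-deal 2026-09-02T04:06Z, road (i)+(iii)).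
Seat LD1-p01 (g0).  THEOREMS ONLY (no `def`, no instance, no notation, no named fact, no `sorry`); `--supports stmt-HodgeConjecture-24832 --as helper`.
HC_CM is proved only modulo the 7 printed citations (2 remaining: hLiu418 = stmt-HodgeConjecture-24832, h413 = stmt-HodgeConjecture-24833) until rung 0
closes; nothing printed is discharged here.

* §1 `charThetaSpaceLe_of_irreducible` (road step (iii), [Liu2021, proof of Prop. 4.13 Case 1: «`V_π = Θ^V(π_W)`»; [Dixmier1977, §5.4]): for a closed
  invariant subspace `Q ⊆ L²([U(H)])` of the right regular representation that is TOPOLOGICALLY IRREDUCIBLE and contains every `(a, ξ)`-theta class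
  `[Θ̃_Ψ(ξ) ∘ ιA]` (all majorant witnesses, all finite invariant measures on `[U(⟨a⟩)]`, all Schwartz–Bruhat `Ψ`), and a discrete `P` containing one
  NON-ZERO such class (the skeleton's `CharSeam₂`): `Q ∩ P` is a non-zero closed invariant subspace of `Q`, hence `= Q` (★
  `ClosedSubrep.eq_of_le_of_isTopIrreducible`), so EVERY `(a, ξ)`-theta class lies in `P` (the skeleton's `CharThetaSpaceLe₂`).  Rank-generic `N`,
  any transport `ιA`; pure Hilbert-space reasoning.
* §2 `exists_closedSubrep_thetaSpan` (road step (i), [Rallis1984, §1]; [GelbartRogawski1991, §3.2 p. 457]): under the letters' scaled frame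
  `formCongr c g (t • H) = diag dV` and a transport PINNED by `↑(ιA k) = g_𝔸⁻¹ k g_𝔸` (continuous and rational-to-rational, ★ `F0LD2FrameTransportPin`),
  the topological closure of the span of all `(a, ξ)`-theta classes is `R`-INVARIANT — `R(k) [Θ̃_Ψ(ξ) ∘ ιA] = [Θ̃_{ω(ιA k, 1)Ψ}(ξ) ∘ ιA]` (★ kit
  `F0LD1ThetaTransportKit.rightRegular_toLp_lineThetaLift`) keeps the generating set stable, `R(k)` is linear and continuous — so it is (the carrier
  of) a `ClosedSubrep` of the right regular representation containing every `(a, ξ)`-theta class.  With §1, half (I-A) of organ (I) is reduced to the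
  ONE remaining input «that closed span is topologically irreducible» (global irreducibility of the theta lift of the character `ξ` of `U(1)`,
  [Rallis1984, §1 Thm.], [Wu2013, Thm. 5.3]) — road step (ii), NOT in this file.

References: [Liu2021] Y. Liu, Camb. J. Math. 9 (2021), proof of Prop. 4.13 Case 1 (p. 48); proof of Prop. D.4 (1) (p. 131).  [Rallis1984] S. Rallis,
Compositio Math. 51 (1984), §1.  [Wu2013] C. Wu, J. Number Theory 133 (2013), Thm. 5.3.  [GelbartRogawski1991] S. Gelbart, J. Rogawski, Invent. Math.
105 (1991), §3.2 p. 457.  [Dixmier1977] J. Dixmier, *C*-algebras* (1977), §5.4.  [DeitmarEchterhoff2014] A. Deitmar, S. Echterhoff (2014), Thm. 7.3.2.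
[BorelJacquet1979] A. Borel, H. Jacquet, PSPM 33.1 (1979), §4.6.
-/

set_option autoImplicit false
-- the mandated namespace has the single-problem summit's repeated segment (`HodgeConjecture.HodgeConjecture`)
set_option linter.dupNamespace false

noncomputable section

open NumberField MeasureTheory IsDedekindDomain
open scoped Matrix Kronecker ComplexOrder ENNReal
open Literature.NumberTheory.Automorphic Literature.NumberTheory.Automorphic.UnitaryGroup
open Literature.NumberTheory.Automorphic.UnitaryGroup.CotangentForms
open Literature.NumberTheory.Automorphic.IdeleClassGroup
open Literature.NumberTheory.Automorphic.Liu2021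
open Literature.NumberTheory.Automorphic.Liu2021.Def411WeilCarriers
open Literature.NumberTheory.Automorphic.Liu2021.Def411WeilCarriersDoubling
open Literature.NumberTheory.GelbartRogawski1991 Literature.NumberTheory.GelbartRogawski1991.UnitaryDualPair
open Literature.NumberTheory.Weil1964
open Literature.RepresentationTheory.Liu2021
open Literature.RepresentationTheory.CompactGroups
open Literature.RepresentationTheory.HeisenbergGroup
open Summit.HodgeConjecture.HodgeConjecture.Cruxes.HLiu418.F0LD2FrameTransportPin

namespace Summit.HodgeConjecture.HodgeConjecture.Cruxes.HLiu418.F0LD1CharThetaSpaceLeOfIrreducible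

/-! ## §1 An irreducible closed invariant subspace containing the `(a, ξ)`-theta classes and meeting `P` in one of them lies in `P` -/

section Irreducible

variable (L : Type) [Field L] [NumberField L] [IsCMField L] (N : ℕ) (H : Matrix (Fin N) (Fin N) L)
  {n' : ℕ} (e₁ : Fin N × Fin 1 ≃ Fin n') (dV : Fin N → L) (hdV : ∀ i, IsCMField.complexConj L (dV i) = dV i)
  (hdV0 : ∀ i, dV i ≠ 0)
  (ιA : (adelicGroupData (↥(maximalRealSubfield L)) L (IsCMField.complexConj L) N H).Adelic →* ↥(UnitaryGroup.adelic (↥(maximalRealSubfield L)) L (IsCMField.complexConj L) N (Matrix.diagonal dV)))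
  [CompactSpace (↥(UnitaryGroup.adelic (↥(maximalRealSubfield L)) L (IsCMField.complexConj L) N (Matrix.diagonal dV)) ⧸ (UnitaryGroup.toAdelic (↥(maximalRealSubfield L)) L (IsCMField.complexConj L) N (Matrix.diagonal dV)).range)]
  {μA : Measure (adelicGroupData (↥(maximalRealSubfield L)) L (IsCMField.complexConj L) N H).automorphicQuotient} [(adelicGroupData (↥(maximalRealSubfield L)) L (IsCMField.complexConj L) N H).IsAutomorphicMeasure μA]

/-- **BRICK 1 of half (I-A): `CharSeam₂ ⟹ CharThetaSpaceLe₂` GIVEN an irreducible closed invariant subspace `Q` containing every `(a, ξ)`-theta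
class.**  If `Q` (a closed `R`-invariant subspace of `L²([U(H)])`, topologically irreducible) contains every class `[Θ̃_Ψ(ξ) ∘ ιA]` (all majorant witnesses,
finite invariant measures, Schwartz–Bruhat `Ψ`), and the discrete `P` contains one non-zero such class (the body of the skeleton's `CharSeam₂ … P μ hμ a ιA ξ`),
then every such class lies in `P` (the body of the skeleton's `CharThetaSpaceLe₂ … P μ hμ a ιA ξ`): `Q ∩ P` is closed, invariant, non-zero, inside the
irreducible `Q`, hence all of `Q` (★ `ClosedSubrep.eq_of_le_of_isTopIrreducible`).  Rank-generic `N`, arbitrary transport `ιA`.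
[cite: Liu2021, proof of Prop. 4.13 Case 1 (p. 48)] [cite: Dixmier1977, §5.4] [cite: DeitmarEchterhoff2014, Thm. 7.3.2] -/
theorem charThetaSpaceLe_of_irreducible (P : DiscreteAutomorphicRep (adelicGroupData (↥(maximalRealSubfield L)) L (IsCMField.complexConj L) N H) μA)
    (μ : Literature.NumberTheory.Automorphic.IdeleClassGroup L →ₜ* Circle) (hμ : IsConjugateSymplectic L μ) (a : (↥(maximalRealSubfield L))ˣ)
    (ξ : haveI := normal_range_toAdelic_JW L a
      PontryaginDual (↥(UnitaryGroup.adelic (↥(maximalRealSubfield L)) L (IsCMField.complexConj L) 1 (JW (↥(maximalRealSubfield L)) L a)) ⧸ (UnitaryGroup.toAdelic (↥(maximalRealSubfield L)) L (IsCMField.complexConj L) 1 (JW (↥(maximalRealSubfield L)) L a)).range))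
    (Q : ContRepresentation.ClosedSubrep ((adelicGroupData (↥(maximalRealSubfield L)) L (IsCMField.complexConj L) N H).rightRegular μA)) (hQirr : Q.toContRep.IsTopIrreducible)
    (hQ : letI : MeasurableSpace (↥(UnitaryGroup.adelic (↥(maximalRealSubfield L)) L (IsCMField.complexConj L) 1 (JW (↥(maximalRealSubfield L)) L a)) ⧸ (UnitaryGroup.toAdelic (↥(maximalRealSubfield L)) L (IsCMField.complexConj L) 1 (JW (↥(maximalRealSubfield L)) L a)).range) := borel _
      haveI := normal_range_toAdelic_JW L a
      ∀ (hρ : HasThetaMajorants fun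
      (p : ↥(UnitaryGroup.adelic (↥(maximalRealSubfield L)) L (IsCMField.complexConj L) N (Matrix.diagonal dV)) × ↥(UnitaryGroup.adelic (↥(maximalRealSubfield L)) L (IsCMField.complexConj L) 1 (JW (↥(maximalRealSubfield L)) L a))) (Φ : piSchwartzBruhat (↥(maximalRealSubfield L)) (Fin n')) =>
        pairRep (↥(maximalRealSubfield L)) L (IsCMField.complexConj L) N 1 e₁ (Matrix.diagonal dV) (JW (↥(maximalRealSubfield L)) L a)
          (chiSplittingLine L e₁ dV hdV hdV0 (toHeckeCharacter L μ) (isUnitary_toHeckeCharacter L μ)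
            ((isOscillatorChar_toHeckeCharacter_iff μ).mpr hμ) (TW (↥(maximalRealSubfield L)) a)
            (isUnit_det_TW (↥(maximalRealSubfield L)) a) (JW (↥(maximalRealSubfield L)) L a) (JW_eq (↥(maximalRealSubfield L)) L a))
          p Φ)
      (μW : Measure (↥(UnitaryGroup.adelic (↥(maximalRealSubfield L)) L (IsCMField.complexConj L) 1 (JW (↥(maximalRealSubfield L)) L a)) ⧸ (UnitaryGroup.toAdelic (↥(maximalRealSubfield L)) L (IsCMField.complexConj L) 1 (JW (↥(maximalRealSubfield L)) L a)).range)) (_ : IsFiniteMeasure μW)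
      (_ : SMulInvariantMeasure ↥(UnitaryGroup.adelic (↥(maximalRealSubfield L)) L (IsCMField.complexConj L) 1 (JW (↥(maximalRealSubfield L)) L a)) (↥(UnitaryGroup.adelic (↥(maximalRealSubfield L)) L (IsCMField.complexConj L) 1 (JW (↥(maximalRealSubfield L)) L a)) ⧸ (UnitaryGroup.toAdelic (↥(maximalRealSubfield L)) L (IsCMField.complexConj L) 1 (JW (↥(maximalRealSubfield L)) L a)).range) μW)
      (Ψ : piSchwartzBruhat (↥(maximalRealSubfield L)) (Fin n'))
      (hθ : MemLp (toQuotFun (adelicGroupData (↥(maximalRealSubfield L)) L (IsCMField.complexConj L) N H) fun x =>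
        (lineThetaKernelDatum L N e₁ dV hdV hdV0 μ hμ a hρ).thetaLiftFun μW Ψ (charCM ξ) (ιA x)) 2 μA),
      MemLp.toLp _ hθ ∈ Q.toSubmodule)
    (hseam : letI : MeasurableSpace (↥(UnitaryGroup.adelic (↥(maximalRealSubfield L)) L (IsCMField.complexConj L) 1 (JW (↥(maximalRealSubfield L)) L a)) ⧸ (UnitaryGroup.toAdelic (↥(maximalRealSubfield L)) L (IsCMField.complexConj L) 1 (JW (↥(maximalRealSubfield L)) L a)).range) := borel _
      haveI := normal_range_toAdelic_JW L a
      ∃ (hρ : HasThetaMajorants fun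
      (p : ↥(UnitaryGroup.adelic (↥(maximalRealSubfield L)) L (IsCMField.complexConj L) N (Matrix.diagonal dV)) × ↥(UnitaryGroup.adelic (↥(maximalRealSubfield L)) L (IsCMField.complexConj L) 1 (JW (↥(maximalRealSubfield L)) L a))) (Φ : piSchwartzBruhat (↥(maximalRealSubfield L)) (Fin n')) =>
        pairRep (↥(maximalRealSubfield L)) L (IsCMField.complexConj L) N 1 e₁ (Matrix.diagonal dV) (JW (↥(maximalRealSubfield L)) L a)
          (chiSplittingLine L e₁ dV hdV hdV0 (toHeckeCharacter L μ) (isUnitary_toHeckeCharacter L μ)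
            ((isOscillatorChar_toHeckeCharacter_iff μ).mpr hμ) (TW (↥(maximalRealSubfield L)) a)
            (isUnit_det_TW (↥(maximalRealSubfield L)) a) (JW (↥(maximalRealSubfield L)) L a) (JW_eq (↥(maximalRealSubfield L)) L a))
          p Φ)
      (μW : Measure (↥(UnitaryGroup.adelic (↥(maximalRealSubfield L)) L (IsCMField.complexConj L) 1 (JW (↥(maximalRealSubfield L)) L a)) ⧸ (UnitaryGroup.toAdelic (↥(maximalRealSubfield L)) L (IsCMField.complexConj L) 1 (JW (↥(maximalRealSubfield L)) L a)).range)) (_ : IsFiniteMeasure μW)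
      (_ : SMulInvariantMeasure ↥(UnitaryGroup.adelic (↥(maximalRealSubfield L)) L (IsCMField.complexConj L) 1 (JW (↥(maximalRealSubfield L)) L a)) (↥(UnitaryGroup.adelic (↥(maximalRealSubfield L)) L (IsCMField.complexConj L) 1 (JW (↥(maximalRealSubfield L)) L a)) ⧸ (UnitaryGroup.toAdelic (↥(maximalRealSubfield L)) L (IsCMField.complexConj L) 1 (JW (↥(maximalRealSubfield L)) L a)).range) μW)
      (Ψ : piSchwartzBruhat (↥(maximalRealSubfield L)) (Fin n'))
      (hθ : MemLp (toQuotFun (adelicGroupData (↥(maximalRealSubfield L)) L (IsCMField.complexConj L) N H) fun x =>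
        (lineThetaKernelDatum L N e₁ dV hdV hdV0 μ hμ a hρ).thetaLiftFun μW Ψ (charCM ξ) (ιA x)) 2 μA),
      MemLp.toLp _ hθ ∈ P.space.toSubmodule ∧ MemLp.toLp _ hθ ≠ 0) :
    letI : MeasurableSpace (↥(UnitaryGroup.adelic (↥(maximalRealSubfield L)) L (IsCMField.complexConj L) 1 (JW (↥(maximalRealSubfield L)) L a)) ⧸ (UnitaryGroup.toAdelic (↥(maximalRealSubfield L)) L (IsCMField.complexConj L) 1 (JW (↥(maximalRealSubfield L)) L a)).range) := borel _
    haveI := normal_range_toAdelic_JW L a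
    ∀ (hρ : HasThetaMajorants fun
      (p : ↥(UnitaryGroup.adelic (↥(maximalRealSubfield L)) L (IsCMField.complexConj L) N (Matrix.diagonal dV)) × ↥(UnitaryGroup.adelic (↥(maximalRealSubfield L)) L (IsCMField.complexConj L) 1 (JW (↥(maximalRealSubfield L)) L a))) (Φ : piSchwartzBruhat (↥(maximalRealSubfield L)) (Fin n')) =>
        pairRep (↥(maximalRealSubfield L)) L (IsCMField.complexConj L) N 1 e₁ (Matrix.diagonal dV) (JW (↥(maximalRealSubfield L)) L a)
          (chiSplittingLine L e₁ dV hdV hdV0 (toHeckeCharacter L μ) (isUnitary_toHeckeCharacter L μ)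
            ((isOscillatorChar_toHeckeCharacter_iff μ).mpr hμ) (TW (↥(maximalRealSubfield L)) a)
            (isUnit_det_TW (↥(maximalRealSubfield L)) a) (JW (↥(maximalRealSubfield L)) L a) (JW_eq (↥(maximalRealSubfield L)) L a))
          p Φ)
      (μW : Measure (↥(UnitaryGroup.adelic (↥(maximalRealSubfield L)) L (IsCMField.complexConj L) 1 (JW (↥(maximalRealSubfield L)) L a)) ⧸ (UnitaryGroup.toAdelic (↥(maximalRealSubfield L)) L (IsCMField.complexConj L) 1 (JW (↥(maximalRealSubfield L)) L a)).range)) (_ : IsFiniteMeasure μW)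
      (_ : SMulInvariantMeasure ↥(UnitaryGroup.adelic (↥(maximalRealSubfield L)) L (IsCMField.complexConj L) 1 (JW (↥(maximalRealSubfield L)) L a)) (↥(UnitaryGroup.adelic (↥(maximalRealSubfield L)) L (IsCMField.complexConj L) 1 (JW (↥(maximalRealSubfield L)) L a)) ⧸ (UnitaryGroup.toAdelic (↥(maximalRealSubfield L)) L (IsCMField.complexConj L) 1 (JW (↥(maximalRealSubfield L)) L a)).range) μW)
      (Ψ : piSchwartzBruhat (↥(maximalRealSubfield L)) (Fin n'))
      (hθ : MemLp (toQuotFun (adelicGroupData (↥(maximalRealSubfield L)) L (IsCMField.complexConj L) N H) fun x =>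
        (lineThetaKernelDatum L N e₁ dV hdV hdV0 μ hμ a hρ).thetaLiftFun μW Ψ (charCM ξ) (ιA x)) 2 μA),
      MemLp.toLp _ hθ ∈ P.space.toSubmodule := by
  letI : MeasurableSpace (↥(UnitaryGroup.adelic (↥(maximalRealSubfield L)) L (IsCMField.complexConj L) 1 (JW (↥(maximalRealSubfield L)) L a)) ⧸ (UnitaryGroup.toAdelic (↥(maximalRealSubfield L)) L (IsCMField.complexConj L) 1 (JW (↥(maximalRealSubfield L)) L a)).range) := borel _
  haveI hN := normal_range_toAdelic_JW L a
  obtain ⟨hρ₀, μW₀, hfin₀, hinv₀, Ψ₀, hθ₀, hmem₀, hne₀⟩ := hseam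
  -- `X = Q ∩ P`, a closed invariant subspace of the irreducible `Q`, non-zero (it contains the seam's class), hence `X = Q`
  let X : ContRepresentation.ClosedSubrep ((adelicGroupData (↥(maximalRealSubfield L)) L (IsCMField.complexConj L) N H).rightRegular μA) :=
    { toSubmodule := Q.toSubmodule ⊓ P.space.toSubmodule
      apply_mem_toSubmodule := fun k w hw => ⟨Q.apply_mem_toSubmodule k hw.1, P.space.apply_mem_toSubmodule k hw.2⟩
      isClosed' := Q.isClosed'.inter P.space.isClosed' }
  have hX : Nontrivial X.toSubmodule :=
    ⟨⟨⟨MemLp.toLp _ hθ₀, ⟨hQ hρ₀ μW₀ hfin₀ hinv₀ Ψ₀ hθ₀, hmem₀⟩⟩, 0, fun h => hne₀ (congrArg Subtype.val h)⟩⟩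
  have hXQ : X = Q :=
    ContRepresentation.ClosedSubrep.eq_of_le_of_isTopIrreducible hQirr hX (fun w hw => (Submodule.mem_inf.mp hw).1)
  intro hρ μW hfin hinv Ψ hθ
  have hvQ : MemLp.toLp _ hθ ∈ Q.toSubmodule := hQ hρ μW hfin hinv Ψ hθ
  have hvX : MemLp.toLp _ hθ ∈ X.toSubmodule := by rw [hXQ]; exact hvQ
  exact (Submodule.mem_inf.mp hvX).2

end Irreducible

/-! ## §2 The theta span: the closure of the span of all `(a, ξ)`-theta classes is a closed `R`-invariant subspace -/

section Span

variable (L : Type) [Field L] [NumberField L] [IsCMField L] (N : ℕ) (H : Matrix (Fin N) (Fin N) L)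
  {n' : ℕ} (e₁ : Fin N × Fin 1 ≃ Fin n') (dV : Fin N → L) (hdV : ∀ i, IsCMField.complexConj L (dV i) = dV i)
  (hdV0 : ∀ i, dV i ≠ 0) (t : L) (ht : t ≠ 0) (g : GL (Fin N) L)
  (hg : formCongr ((IsCMField.complexConj L : L ≃ₐ[(↥(maximalRealSubfield L))] L) : L →+* L) g (t • H) = Matrix.diagonal dV)
  (ιA : (adelicGroupData (↥(maximalRealSubfield L)) L (IsCMField.complexConj L) N H).Adelic →* ↥(UnitaryGroup.adelic (↥(maximalRealSubfield L)) L (IsCMField.complexConj L) N (Matrix.diagonal dV)))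
  (hιA : ∀ k, ((ιA k : ↥(UnitaryGroup.adelic (↥(maximalRealSubfield L)) L (IsCMField.complexConj L) N (Matrix.diagonal dV))) : GL (Fin N) (AdeleRing (𝓞 L) L)) =
    (toAdeleGL L g)⁻¹ * adelicVal (↥(maximalRealSubfield L)) L (IsCMField.complexConj L) N H k * toAdeleGL L g)
  [CompactSpace (↥(UnitaryGroup.adelic (↥(maximalRealSubfield L)) L (IsCMField.complexConj L) N (Matrix.diagonal dV)) ⧸ (UnitaryGroup.toAdelic (↥(maximalRealSubfield L)) L (IsCMField.complexConj L) N (Matrix.diagonal dV)).range)]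
  {μA : Measure (adelicGroupData (↥(maximalRealSubfield L)) L (IsCMField.complexConj L) N H).automorphicQuotient} [(adelicGroupData (↥(maximalRealSubfield L)) L (IsCMField.complexConj L) N H).IsAutomorphicMeasure μA] [CompactSpace (adelicGroupData (↥(maximalRealSubfield L)) L (IsCMField.complexConj L) N H).automorphicQuotient]

include ht hg hιA in
/-- **The THETA SPAN is a closed invariant subspace**: under the scaled frame and a pinned transport `ιA`, there is a closed `R`-invariant subspace
`Q ⊆ L²([U(H)])` (namely the topological closure of the span of ALL `(a, ξ)`-theta classes `[Θ̃_Ψ(ξ) ∘ ιA]`, all majorant witnesses, finite invariant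
measures and Schwartz–Bruhat `Ψ`) which contains every such class and whose carrier IS that closure.  Invariance: `R(k) [Θ̃_Ψ(ξ) ∘ ιA] =
[Θ̃_{ω(ιA k, 1)Ψ}(ξ) ∘ ιA]` (★ kit `F0LD1ThetaTransportKit.rightRegular_toLp_lineThetaLift`; the transport is continuous and rational-to-rational by ★
`F0LD2FrameTransportPin`) keeps the generating set stable; `R(k)` is linear (`Submodule.span_induction`) and continuous (`map_closure_subset`-style
`image_closure_subset_closure_image`). [cite: Rallis1984, §1] [cite: GelbartRogawski1991, §3.2 p. 457] [cite: BorelJacquet1979, §4.6] -/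
theorem exists_closedSubrep_thetaSpan
    (μ : Literature.NumberTheory.Automorphic.IdeleClassGroup L →ₜ* Circle) (hμ : IsConjugateSymplectic L μ) (a : (↥(maximalRealSubfield L))ˣ)
    (ξ : haveI := normal_range_toAdelic_JW L a
      PontryaginDual (↥(UnitaryGroup.adelic (↥(maximalRealSubfield L)) L (IsCMField.complexConj L) 1 (JW (↥(maximalRealSubfield L)) L a)) ⧸ (UnitaryGroup.toAdelic (↥(maximalRealSubfield L)) L (IsCMField.complexConj L) 1 (JW (↥(maximalRealSubfield L)) L a)).range)) :
    letI : MeasurableSpace (↥(UnitaryGroup.adelic (↥(maximalRealSubfield L)) L (IsCMField.complexConj L) 1 (JW (↥(maximalRealSubfield L)) L a)) ⧸ (UnitaryGroup.toAdelic (↥(maximalRealSubfield L)) L (IsCMField.complexConj L) 1 (JW (↥(maximalRealSubfield L)) L a)).range) := borel _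
    haveI := normal_range_toAdelic_JW L a
    ∃ Q : ContRepresentation.ClosedSubrep ((adelicGroupData (↥(maximalRealSubfield L)) L (IsCMField.complexConj L) N H).rightRegular μA),
      (∀ (hρ : HasThetaMajorants fun
      (p : ↥(UnitaryGroup.adelic (↥(maximalRealSubfield L)) L (IsCMField.complexConj L) N (Matrix.diagonal dV)) × ↥(UnitaryGroup.adelic (↥(maximalRealSubfield L)) L (IsCMField.complexConj L) 1 (JW (↥(maximalRealSubfield L)) L a))) (Φ : piSchwartzBruhat (↥(maximalRealSubfield L)) (Fin n')) =>
        pairRep (↥(maximalRealSubfield L)) L (IsCMField.complexConj L) N 1 e₁ (Matrix.diagonal dV) (JW (↥(maximalRealSubfield L)) L a)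
          (chiSplittingLine L e₁ dV hdV hdV0 (toHeckeCharacter L μ) (isUnitary_toHeckeCharacter L μ)
            ((isOscillatorChar_toHeckeCharacter_iff μ).mpr hμ) (TW (↥(maximalRealSubfield L)) a)
            (isUnit_det_TW (↥(maximalRealSubfield L)) a) (JW (↥(maximalRealSubfield L)) L a) (JW_eq (↥(maximalRealSubfield L)) L a))
          p Φ)
        (μW : Measure (↥(UnitaryGroup.adelic (↥(maximalRealSubfield L)) L (IsCMField.complexConj L) 1 (JW (↥(maximalRealSubfield L)) L a)) ⧸ (UnitaryGroup.toAdelic (↥(maximalRealSubfield L)) L (IsCMField.complexConj L) 1 (JW (↥(maximalRealSubfield L)) L a)).range)) (_ : IsFiniteMeasure μW)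
        (_ : SMulInvariantMeasure ↥(UnitaryGroup.adelic (↥(maximalRealSubfield L)) L (IsCMField.complexConj L) 1 (JW (↥(maximalRealSubfield L)) L a)) (↥(UnitaryGroup.adelic (↥(maximalRealSubfield L)) L (IsCMField.complexConj L) 1 (JW (↥(maximalRealSubfield L)) L a)) ⧸ (UnitaryGroup.toAdelic (↥(maximalRealSubfield L)) L (IsCMField.complexConj L) 1 (JW (↥(maximalRealSubfield L)) L a)).range) μW)
        (Ψ : piSchwartzBruhat (↥(maximalRealSubfield L)) (Fin n'))
        (hθ : MemLp (toQuotFun (adelicGroupData (↥(maximalRealSubfield L)) L (IsCMField.complexConj L) N H) fun x =>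
          (lineThetaKernelDatum L N e₁ dV hdV hdV0 μ hμ a hρ).thetaLiftFun μW Ψ (charCM ξ) (ιA x)) 2 μA),
        MemLp.toLp _ hθ ∈ Q.toSubmodule) ∧
      (Q.toSubmodule : Set ((adelicGroupData (↥(maximalRealSubfield L)) L (IsCMField.complexConj L) N H).L2 μA)) = closure (Submodule.span ℂ
        {v : (adelicGroupData (↥(maximalRealSubfield L)) L (IsCMField.complexConj L) N H).L2 μA | ∃ (hρ : HasThetaMajorants fun
      (p : ↥(UnitaryGroup.adelic (↥(maximalRealSubfield L)) L (IsCMField.complexConj L) N (Matrix.diagonal dV)) × ↥(UnitaryGroup.adelic (↥(maximalRealSubfield L)) L (IsCMField.complexConj L) 1 (JW (↥(maximalRealSubfield L)) L a))) (Φ : piSchwartzBruhat (↥(maximalRealSubfield L)) (Fin n')) =>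
        pairRep (↥(maximalRealSubfield L)) L (IsCMField.complexConj L) N 1 e₁ (Matrix.diagonal dV) (JW (↥(maximalRealSubfield L)) L a)
          (chiSplittingLine L e₁ dV hdV hdV0 (toHeckeCharacter L μ) (isUnitary_toHeckeCharacter L μ)
            ((isOscillatorChar_toHeckeCharacter_iff μ).mpr hμ) (TW (↥(maximalRealSubfield L)) a)
            (isUnit_det_TW (↥(maximalRealSubfield L)) a) (JW (↥(maximalRealSubfield L)) L a) (JW_eq (↥(maximalRealSubfield L)) L a))
          p Φ)
        (μW : Measure (↥(UnitaryGroup.adelic (↥(maximalRealSubfield L)) L (IsCMField.complexConj L) 1 (JW (↥(maximalRealSubfield L)) L a)) ⧸ (UnitaryGroup.toAdelic (↥(maximalRealSubfield L)) L (IsCMField.complexConj L) 1 (JW (↥(maximalRealSubfield L)) L a)).range)) (_ : IsFiniteMeasure μW)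
        (_ : SMulInvariantMeasure ↥(UnitaryGroup.adelic (↥(maximalRealSubfield L)) L (IsCMField.complexConj L) 1 (JW (↥(maximalRealSubfield L)) L a)) (↥(UnitaryGroup.adelic (↥(maximalRealSubfield L)) L (IsCMField.complexConj L) 1 (JW (↥(maximalRealSubfield L)) L a)) ⧸ (UnitaryGroup.toAdelic (↥(maximalRealSubfield L)) L (IsCMField.complexConj L) 1 (JW (↥(maximalRealSubfield L)) L a)).range) μW)
        (Ψ : piSchwartzBruhat (↥(maximalRealSubfield L)) (Fin n'))
        (hθ : MemLp (toQuotFun (adelicGroupData (↥(maximalRealSubfield L)) L (IsCMField.complexConj L) N H) fun x =>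
          (lineThetaKernelDatum L N e₁ dV hdV hdV0 μ hμ a hρ).thetaLiftFun μW Ψ (charCM ξ) (ιA x)) 2 μA),
        v = MemLp.toLp _ hθ} : Set ((adelicGroupData (↥(maximalRealSubfield L)) L (IsCMField.complexConj L) N H).L2 μA)) := by
  letI : MeasurableSpace (↥(UnitaryGroup.adelic (↥(maximalRealSubfield L)) L (IsCMField.complexConj L) 1 (JW (↥(maximalRealSubfield L)) L a)) ⧸ (UnitaryGroup.toAdelic (↥(maximalRealSubfield L)) L (IsCMField.complexConj L) 1 (JW (↥(maximalRealSubfield L)) L a)).range) := borel _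
  haveI : BorelSpace (↥(UnitaryGroup.adelic (↥(maximalRealSubfield L)) L (IsCMField.complexConj L) 1 (JW (↥(maximalRealSubfield L)) L a)) ⧸ (UnitaryGroup.toAdelic (↥(maximalRealSubfield L)) L (IsCMField.complexConj L) 1 (JW (↥(maximalRealSubfield L)) L a)).range) := ⟨rfl⟩
  haveI hN := normal_range_toAdelic_JW L a
  -- the transport is continuous and carries rational points to rational points (★ `F0LD2FrameTransportPin`)
  have hT : Continuous ιA ∧ ∀ ⦃γ : (adelicGroupData (↥(maximalRealSubfield L)) L (IsCMField.complexConj L) N H).Adelic⦄,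
      γ ∈ (UnitaryGroup.toAdelic (↥(maximalRealSubfield L)) L (IsCMField.complexConj L) N H).range →
        ιA γ ∈ (UnitaryGroup.toAdelic (↥(maximalRealSubfield L)) L (IsCMField.complexConj L) N (Matrix.diagonal dV)).range :=
    ⟨continuous_of_pin L N H dV g ιA hιA, fun γ hγ => mem_range_toAdelic_of_pin L N H dV t ht g hg ιA hιA hγ⟩
  -- the generating set `S` of all `(a, ξ)`-theta classes is stable under every `R(k)`
  set S : Set ((adelicGroupData (↥(maximalRealSubfield L)) L (IsCMField.complexConj L) N H).L2 μA) := {v : (adelicGroupData (↥(maximalRealSubfield L)) L (IsCMField.complexConj L) N H).L2 μA | ∃ (hρ : HasThetaMajorants fun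
      (p : ↥(UnitaryGroup.adelic (↥(maximalRealSubfield L)) L (IsCMField.complexConj L) N (Matrix.diagonal dV)) × ↥(UnitaryGroup.adelic (↥(maximalRealSubfield L)) L (IsCMField.complexConj L) 1 (JW (↥(maximalRealSubfield L)) L a))) (Φ : piSchwartzBruhat (↥(maximalRealSubfield L)) (Fin n')) =>
        pairRep (↥(maximalRealSubfield L)) L (IsCMField.complexConj L) N 1 e₁ (Matrix.diagonal dV) (JW (↥(maximalRealSubfield L)) L a)
          (chiSplittingLine L e₁ dV hdV hdV0 (toHeckeCharacter L μ) (isUnitary_toHeckeCharacter L μ)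
            ((isOscillatorChar_toHeckeCharacter_iff μ).mpr hμ) (TW (↥(maximalRealSubfield L)) a)
            (isUnit_det_TW (↥(maximalRealSubfield L)) a) (JW (↥(maximalRealSubfield L)) L a) (JW_eq (↥(maximalRealSubfield L)) L a))
          p Φ)
        (μW : Measure (↥(UnitaryGroup.adelic (↥(maximalRealSubfield L)) L (IsCMField.complexConj L) 1 (JW (↥(maximalRealSubfield L)) L a)) ⧸ (UnitaryGroup.toAdelic (↥(maximalRealSubfield L)) L (IsCMField.complexConj L) 1 (JW (↥(maximalRealSubfield L)) L a)).range)) (_ : IsFiniteMeasure μW)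
        (_ : SMulInvariantMeasure ↥(UnitaryGroup.adelic (↥(maximalRealSubfield L)) L (IsCMField.complexConj L) 1 (JW (↥(maximalRealSubfield L)) L a)) (↥(UnitaryGroup.adelic (↥(maximalRealSubfield L)) L (IsCMField.complexConj L) 1 (JW (↥(maximalRealSubfield L)) L a)) ⧸ (UnitaryGroup.toAdelic (↥(maximalRealSubfield L)) L (IsCMField.complexConj L) 1 (JW (↥(maximalRealSubfield L)) L a)).range) μW)
        (Ψ : piSchwartzBruhat (↥(maximalRealSubfield L)) (Fin n'))
        (hθ : MemLp (toQuotFun (adelicGroupData (↥(maximalRealSubfield L)) L (IsCMField.complexConj L) N H) fun x =>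
          (lineThetaKernelDatum L N e₁ dV hdV hdV0 μ hμ a hρ).thetaLiftFun μW Ψ (charCM ξ) (ιA x)) 2 μA),
        v = MemLp.toLp _ hθ} with hS
  have hstab : ∀ (k : (adelicGroupData (↥(maximalRealSubfield L)) L (IsCMField.complexConj L) N H).Adelic), ∀ v ∈ S, (adelicGroupData (↥(maximalRealSubfield L)) L (IsCMField.complexConj L) N H).rightRegular μA k v ∈ S := by
    rintro k v ⟨hρ, μW, hfin, hinv, Ψ, hθ, rfl⟩
    haveI := hfin
    haveI := hinv
    refine ⟨hρ, μW, hfin, hinv, pairRep (↥(maximalRealSubfield L)) L (IsCMField.complexConj L) N 1 e₁ (Matrix.diagonal dV) (JW (↥(maximalRealSubfield L)) L a)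
          (chiSplittingLine L e₁ dV hdV hdV0 (toHeckeCharacter L μ) (isUnitary_toHeckeCharacter L μ)
            ((isOscillatorChar_toHeckeCharacter_iff μ).mpr hμ) (TW (↥(maximalRealSubfield L)) a)
            (isUnit_det_TW (↥(maximalRealSubfield L)) a) (JW (↥(maximalRealSubfield L)) L a) (JW_eq (↥(maximalRealSubfield L)) L a)) (ιA k, 1) Ψ,
      F0LD1ThetaTransportKit.memLp_toQuotFun_lineThetaLift L N H e₁ dV hdV hdV0 ιA hT μ hμ a hρ μW _ (charCM ξ) μA 2, ?_⟩
    exact F0LD1ThetaTransportKit.rightRegular_toLp_lineThetaLift L N H e₁ dV hdV hdV0 ιA hT μ hμ a hρ μW Ψ (charCM ξ) μA k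
  -- hence so is its span …
  have hspan : ∀ (k : (adelicGroupData (↥(maximalRealSubfield L)) L (IsCMField.complexConj L) N H).Adelic), ∀ v ∈ Submodule.span ℂ S, (adelicGroupData (↥(maximalRealSubfield L)) L (IsCMField.complexConj L) N H).rightRegular μA k v ∈ Submodule.span ℂ S := by
    intro k v hv
    refine Submodule.span_induction (p := fun v _ => (adelicGroupData (↥(maximalRealSubfield L)) L (IsCMField.complexConj L) N H).rightRegular μA k v ∈ Submodule.span ℂ S) ?_ ?_ ?_ ?_ hv
    · exact fun v hv => Submodule.subset_span (hstab k v hv)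
    · rw [map_zero]; exact Submodule.zero_mem _
    · intro x y _ _ hx hy
      rw [map_add]; exact Submodule.add_mem _ hx hy
    · intro c x _ hx
      rw [map_smul]; exact Submodule.smul_mem _ c hx
  -- … and the closure of the span (`R(k)` is continuous)
  have hclos : ∀ (k : (adelicGroupData (↥(maximalRealSubfield L)) L (IsCMField.complexConj L) N H).Adelic), ∀ v ∈ closure (Submodule.span ℂ S : Set ((adelicGroupData (↥(maximalRealSubfield L)) L (IsCMField.complexConj L) N H).L2 μA)),
      (adelicGroupData (↥(maximalRealSubfield L)) L (IsCMField.complexConj L) N H).rightRegular μA k v ∈ closure (Submodule.span ℂ S : Set ((adelicGroupData (↥(maximalRealSubfield L)) L (IsCMField.complexConj L) N H).L2 μA)) := by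
    intro k v hv
    have h1 : (adelicGroupData (↥(maximalRealSubfield L)) L (IsCMField.complexConj L) N H).rightRegular μA k v ∈ closure (((adelicGroupData (↥(maximalRealSubfield L)) L (IsCMField.complexConj L) N H).rightRegular μA k) '' (Submodule.span ℂ S : Set ((adelicGroupData (↥(maximalRealSubfield L)) L (IsCMField.complexConj L) N H).L2 μA))) :=
      image_closure_subset_closure_image ((adelicGroupData (↥(maximalRealSubfield L)) L (IsCMField.complexConj L) N H).rightRegular μA k).continuous ⟨v, hv, rfl⟩
    exact closure_mono (Set.image_subset_iff.2 fun w hw => hspan k w hw) h1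
  let Q : ContRepresentation.ClosedSubrep ((adelicGroupData (↥(maximalRealSubfield L)) L (IsCMField.complexConj L) N H).rightRegular μA) :=
    { toSubmodule := (Submodule.span ℂ S).topologicalClosure
      apply_mem_toSubmodule := fun k w hw => hclos k w hw
      isClosed' := (Submodule.span ℂ S).isClosed_topologicalClosure }
  refine ⟨Q, ?_, ?_⟩
  · intro hρ μW hfin hinv Ψ hθ
    exact (Submodule.span ℂ S).le_topologicalClosure (Submodule.subset_span ⟨hρ, μW, hfin, hinv, Ψ, hθ, rfl⟩)
  · rfl

end Span

end Summit.HodgeConjecture.HodgeConjecture.Cruxes.HLiu418.F0LD1CharThetaSpaceLeOfIrreducible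

end
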